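import Literature.NumberTheory.ModularForms.PoincareSeriesWeightTwoHecke
import Mathlib.MeasureTheory.Function.L2Space
import HarnessLib

/-!
# Cauchy–Schwarz for the Petersson pairing of functions on `Γ₀(N)\ℍ`

Topic `Literature/NumberTheory/ModularForms` (namespace `Literature.NumberTheory.ModularForms.PoincareWeightTwo`,
continuing `PoincareSeriesWeightTwoHecke.lean`). THEOREMS ONLY. For the pairing
`peterssonPairing N k g₁ g₂ = ∫_{Γ₀(N)\ℍ} conj(g₁) g₂ yᵏ dμ` (realised on `ModularGroup.fd` with the sum
over `SL(2,ℤ)/Γ₀(N)`, Iwaniec–Kowalski (14.11)) and square-integrable `g₁, g₂`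
(`PeterssonSqIntegrable N k gᵢ`):

* `peterssonPairing_self_re` — `Re ⟨g, g⟩ = ∫ Σ_q |g(q⁻¹τ)|² (Im q⁻¹τ)ᵏ`;
* `norm_peterssonPairing_le` — **`|⟨g₁, g₂⟩| ≤ √Re⟨g₁,g₁⟩ · √Re⟨g₂,g₂⟩`** (Cauchy–Schwarz on the finite
  coset sum, then Hölder with exponents `2, 2` on the fundamental domain).

This is the inequality by which the assembly stub T7 of the I1 fact skeleton
`Summits/Parity/GeneralizedHardyLittlewood/Cruxes/PeterssonBoundPrinted/Lines/poincare_hecke.lean` passes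
from the `L²` convergence of Hecke's family `yˢP_m(·,s)` (stub T4) to the convergence of the pairings
`⟨yˢP_m(·,s), f⟩ → ⟨P_m, f⟩` (Kowalski–Michel 2000 / Iwaniec–Kowalski Lemma 14.3 at weight 2).

## References

* [IwaniecKowalski2004] H. Iwaniec, E. Kowalski, *Analytic Number Theory*, (14.11) (the Petersson
  inner product), §14.2.
-/

noncomputable section

open scoped MatrixGroups Real ComplexConjugate
open CongruenceSubgroup Complex MeasureTheory
open UpperHalfPlane hiding I

namespace Literature.NumberTheory.ModularForms.PoincareWeightTwo

variable {N : ℕ} [NeZero N] {k : ℤ}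

/-- `conj(g w) g w (Im w)ᵏ = |g w|² (Im w)ᵏ` is real and non-negative. [cite: IwaniecKowalski2004, (14.11)] -/
theorem petersson_self_eq_ofReal (k : ℤ) (g : ℍ → ℂ) (w : ℍ) :
    petersson k g g w = ((‖g w‖ ^ 2 * w.im ^ k : ℝ) : ℂ) := by
  rw [petersson, Complex.conj_mul' (g w)]
  push_cast
  ring

/-- The norm of one Petersson integrand: `|conj(g₁ w) g₂ w (Im w)ᵏ| = |g₁ w| |g₂ w| (Im w)ᵏ`.
[cite: IwaniecKowalski2004, (14.11)] -/
theorem norm_petersson (k : ℤ) (g₁ g₂ : ℍ → ℂ) (w : ℍ) :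
    ‖petersson k g₁ g₂ w‖ = ‖g₁ w‖ * ‖g₂ w‖ * w.im ^ k := by
  rw [petersson, norm_mul, norm_mul, Complex.norm_conj, Complex.norm_zpow, Complex.norm_real,
    Real.norm_eq_abs, abs_of_pos w.im_pos]

/-- **`Re ⟨g, g⟩` is the integral of the square-integrand** `Σ_q |g(q⁻¹τ)|² (Im q⁻¹τ)ᵏ` over the
standard fundamental domain. [cite: IwaniecKowalski2004, (14.11)] -/
theorem peterssonPairing_self_re (g : ℍ → ℂ) :
    (peterssonPairing N k g g).re =
      letI := Fintype.ofFinite (𝒮ℒ ⧸ (Gamma0 N : Subgroup (GL (Fin 2) ℝ)).subgroupOf 𝒮ℒ)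
      ∫ τ in ModularGroup.fd, ∑ q : 𝒮ℒ ⧸ (Gamma0 N : Subgroup (GL (Fin 2) ℝ)).subgroupOf 𝒮ℒ,
        ‖g (((q.out : 𝒮ℒ) : GL (Fin 2) ℝ)⁻¹ • τ)‖ ^ 2 *
          ((((q.out : 𝒮ℒ) : GL (Fin 2) ℝ)⁻¹ • τ).im) ^ k := by
  letI := Fintype.ofFinite (𝒮ℒ ⧸ (Gamma0 N : Subgroup (GL (Fin 2) ℝ)).subgroupOf 𝒮ℒ)
  unfold peterssonPairing
  have hpt : (fun τ : ℍ ↦ ∑ q : 𝒮ℒ ⧸ (Gamma0 N : Subgroup (GL (Fin 2) ℝ)).subgroupOf 𝒮ℒ,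
      petersson k g g (((q.out : 𝒮ℒ) : GL (Fin 2) ℝ)⁻¹ • τ)) =
      fun τ : ℍ ↦ ((∑ q : 𝒮ℒ ⧸ (Gamma0 N : Subgroup (GL (Fin 2) ℝ)).subgroupOf 𝒮ℒ,
        ‖g (((q.out : 𝒮ℒ) : GL (Fin 2) ℝ)⁻¹ • τ)‖ ^ 2 *
          ((((q.out : 𝒮ℒ) : GL (Fin 2) ℝ)⁻¹ • τ).im) ^ k : ℝ) : ℂ) := by
    funext τ
    rw [Complex.ofReal_sum]
    exact Finset.sum_congr rfl fun q _ ↦ petersson_self_eq_ofReal k g _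
  rw [hpt, integral_complex_ofReal, Complex.ofReal_re]

/-- Pointwise Cauchy–Schwarz on the coset sum:
`|Σ_q conj(g₁)g₂ yᵏ| ≤ √(Σ_q |g₁|² yᵏ) √(Σ_q |g₂|² yᵏ)`. [cite: IwaniecKowalski2004, (14.11)] -/
theorem norm_sum_petersson_le {ι : Type*} (s : Finset ι) (k : ℤ) (g₁ g₂ : ℍ → ℂ) (w : ι → ℍ) :
    ‖∑ i ∈ s, petersson k g₁ g₂ (w i)‖ ≤
      Real.sqrt (∑ i ∈ s, ‖g₁ (w i)‖ ^ 2 * (w i).im ^ k) *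
        Real.sqrt (∑ i ∈ s, ‖g₂ (w i)‖ ^ 2 * (w i).im ^ k) := by
  have hyk : ∀ i, 0 < (w i).im ^ k := fun i ↦ zpow_pos (w i).im_pos k
  calc ‖∑ i ∈ s, petersson k g₁ g₂ (w i)‖
      ≤ ∑ i ∈ s, ‖petersson k g₁ g₂ (w i)‖ := norm_sum_le _ _
    _ = ∑ i ∈ s, (‖g₁ (w i)‖ * Real.sqrt ((w i).im ^ k)) * (‖g₂ (w i)‖ * Real.sqrt ((w i).im ^ k)) := by
        refine Finset.sum_congr rfl fun i _ ↦ ?_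
        rw [norm_petersson]
        have := Real.mul_self_sqrt (hyk i).le
        calc ‖g₁ (w i)‖ * ‖g₂ (w i)‖ * (w i).im ^ k
            = ‖g₁ (w i)‖ * ‖g₂ (w i)‖ * (Real.sqrt ((w i).im ^ k) * Real.sqrt ((w i).im ^ k)) := by
              rw [this]
          _ = _ := by ring
    _ ≤ Real.sqrt (∑ i ∈ s, (‖g₁ (w i)‖ * Real.sqrt ((w i).im ^ k)) ^ 2) *
          Real.sqrt (∑ i ∈ s, (‖g₂ (w i)‖ * Real.sqrt ((w i).im ^ k)) ^ 2) :=
        Real.sum_mul_le_sqrt_mul_sqrt _ _ _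
    _ = _ := by
        congr 2 <;> refine Finset.sum_congr rfl fun i _ ↦ ?_ <;>
          rw [mul_pow, Real.sq_sqrt (hyk i).le]

/-- **Cauchy–Schwarz for the Petersson pairing of square-integrable functions:**
`|⟨g₁, g₂⟩| ≤ √Re⟨g₁,g₁⟩ · √Re⟨g₂,g₂⟩`. [cite: IwaniecKowalski2004, (14.11)] -/
theorem norm_peterssonPairing_le (g₁ g₂ : ℍ → ℂ) (h₁ : PeterssonSqIntegrable N k g₁)
    (h₂ : PeterssonSqIntegrable N k g₂) :
    ‖peterssonPairing N k g₁ g₂‖ ≤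
      Real.sqrt ((peterssonPairing N k g₁ g₁).re) * Real.sqrt ((peterssonPairing N k g₂ g₂).re) := by
  letI := Fintype.ofFinite (𝒮ℒ ⧸ (Gamma0 N : Subgroup (GL (Fin 2) ℝ)).subgroupOf 𝒮ℒ)
  rw [peterssonPairing_self_re, peterssonPairing_self_re]
  -- the two square-integrands and the cross integrand
  set A : ℍ → ℝ := fun τ ↦ ∑ q : 𝒮ℒ ⧸ (Gamma0 N : Subgroup (GL (Fin 2) ℝ)).subgroupOf 𝒮ℒ,
    ‖g₁ (((q.out : 𝒮ℒ) : GL (Fin 2) ℝ)⁻¹ • τ)‖ ^ 2 * ((((q.out : 𝒮ℒ) : GL (Fin 2) ℝ)⁻¹ • τ).im) ^ k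
    with hA
  set B : ℍ → ℝ := fun τ ↦ ∑ q : 𝒮ℒ ⧸ (Gamma0 N : Subgroup (GL (Fin 2) ℝ)).subgroupOf 𝒮ℒ,
    ‖g₂ (((q.out : 𝒮ℒ) : GL (Fin 2) ℝ)⁻¹ • τ)‖ ^ 2 * ((((q.out : 𝒮ℒ) : GL (Fin 2) ℝ)⁻¹ • τ).im) ^ k
    with hB
  have hA_int : IntegrableOn A ModularGroup.fd := h₁
  have hB_int : IntegrableOn B ModularGroup.fd := h₂
  have hA0 : ∀ τ, 0 ≤ A τ := fun τ ↦ Finset.sum_nonneg fun q _ ↦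
    mul_nonneg (sq_nonneg _) (zpow_pos (UpperHalfPlane.im_pos _) k).le
  have hB0 : ∀ τ, 0 ≤ B τ := fun τ ↦ Finset.sum_nonneg fun q _ ↦
    mul_nonneg (sq_nonneg _) (zpow_pos (UpperHalfPlane.im_pos _) k).le
  -- pointwise Cauchy–Schwarz
  have hX : ∀ τ, ‖∑ q : 𝒮ℒ ⧸ (Gamma0 N : Subgroup (GL (Fin 2) ℝ)).subgroupOf 𝒮ℒ,
      petersson k g₁ g₂ (((q.out : 𝒮ℒ) : GL (Fin 2) ℝ)⁻¹ • τ)‖ ≤ Real.sqrt (A τ) * Real.sqrt (B τ) :=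
    fun τ ↦ norm_sum_petersson_le _ k g₁ g₂ _
  -- measurability and integrability of `√A √B ≤ (A + B)/2`
  have hA_meas : AEStronglyMeasurable (fun τ ↦ Real.sqrt (A τ)) (volume.restrict ModularGroup.fd) :=
    Real.continuous_sqrt.comp_aestronglyMeasurable hA_int.aestronglyMeasurable
  have hB_meas : AEStronglyMeasurable (fun τ ↦ Real.sqrt (B τ)) (volume.restrict ModularGroup.fd) :=
    Real.continuous_sqrt.comp_aestronglyMeasurable hB_int.aestronglyMeasurable
  have hAB_int : Integrable (fun τ ↦ Real.sqrt (A τ) * Real.sqrt (B τ))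
      (volume.restrict ModularGroup.fd) := by
    refine Integrable.mono' ((hA_int.add hB_int).div_const 2) (hA_meas.mul hB_meas)
      (ae_of_all _ fun τ ↦ ?_)
    rw [Real.norm_eq_abs, abs_of_nonneg (by positivity)]
    have h1 := Real.sq_sqrt (hA0 τ)
    have h2 := Real.sq_sqrt (hB0 τ)
    simp only [Pi.add_apply]
    nlinarith [sq_nonneg (Real.sqrt (A τ) - Real.sqrt (B τ)), Real.sqrt_nonneg (A τ),
      Real.sqrt_nonneg (B τ)]
  -- `L²` membership of `√A`, `√B`
  have hA_L2 : MemLp (fun τ ↦ Real.sqrt (A τ)) (ENNReal.ofReal 2) (volume.restrict ModularGroup.fd) := by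
    rw [show ENNReal.ofReal 2 = 2 by norm_num, memLp_two_iff_integrable_sq hA_meas]
    exact hA_int.congr (ae_of_all _ fun τ ↦ by
      show A τ = Real.sqrt (A τ) ^ 2
      rw [Real.sq_sqrt (hA0 τ)])
  have hB_L2 : MemLp (fun τ ↦ Real.sqrt (B τ)) (ENNReal.ofReal 2) (volume.restrict ModularGroup.fd) := by
    rw [show ENNReal.ofReal 2 = 2 by norm_num, memLp_two_iff_integrable_sq hB_meas]
    exact hB_int.congr (ae_of_all _ fun τ ↦ by
      show B τ = Real.sqrt (B τ) ^ 2
      rw [Real.sq_sqrt (hB0 τ)])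
  -- Hölder with exponents `2, 2`
  have hH := integral_mul_le_Lp_mul_Lq_of_nonneg Real.HolderConjugate.two_two
    (ae_of_all _ fun τ ↦ Real.sqrt_nonneg (A τ)) (ae_of_all _ fun τ ↦ Real.sqrt_nonneg (B τ))
    hA_L2 hB_L2
  have hpA : ∫ τ in ModularGroup.fd, Real.sqrt (A τ) ^ (2 : ℝ) = ∫ τ in ModularGroup.fd, A τ :=
    integral_congr_ae (ae_of_all _ fun τ ↦ by
      show Real.sqrt (A τ) ^ (2 : ℝ) = A τ
      rw [Real.rpow_two, Real.sq_sqrt (hA0 τ)])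
  have hpB : ∫ τ in ModularGroup.fd, Real.sqrt (B τ) ^ (2 : ℝ) = ∫ τ in ModularGroup.fd, B τ :=
    integral_congr_ae (ae_of_all _ fun τ ↦ by
      show Real.sqrt (B τ) ^ (2 : ℝ) = B τ
      rw [Real.rpow_two, Real.sq_sqrt (hB0 τ)])
  rw [hpA, hpB] at hH
  -- assemble
  calc ‖peterssonPairing N k g₁ g₂‖
      ≤ ∫ τ in ModularGroup.fd, ‖∑ q : 𝒮ℒ ⧸ (Gamma0 N : Subgroup (GL (Fin 2) ℝ)).subgroupOf 𝒮ℒ,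
          petersson k g₁ g₂ (((q.out : 𝒮ℒ) : GL (Fin 2) ℝ)⁻¹ • τ)‖ := by
        unfold peterssonPairing
        exact norm_integral_le_integral_norm _
    _ ≤ ∫ τ in ModularGroup.fd, Real.sqrt (A τ) * Real.sqrt (B τ) :=
        integral_mono_of_nonneg (ae_of_all _ fun τ ↦ norm_nonneg _) hAB_int (ae_of_all _ hX)
    _ ≤ (∫ τ in ModularGroup.fd, A τ) ^ (1 / (2 : ℝ)) * (∫ τ in ModularGroup.fd, B τ) ^ (1 / (2 : ℝ)) := hH
    _ = Real.sqrt (∫ τ in ModularGroup.fd, A τ) * Real.sqrt (∫ τ in ModularGroup.fd, B τ) := by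
        rw [Real.sqrt_eq_rpow, Real.sqrt_eq_rpow]

end Literature.NumberTheory.ModularForms.PoincareWeightTwo

end
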